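import Summits.CriticalPhenomena.CardyFormulaZ2.Theses.CardyMagicRigidity
import Literature.Probability.Percolation.CardyFormulaConformalInvariance
import Literature.Probability.Percolation.BoxCrossingUpperBound
import Literature.Probability.Percolation.ZdNearCriticalWindow
import Literature.Probability.Percolation.HalfSpacePinnedPairs
import Literature.Probability.Percolation.SharpnessDCTProofs
import Literature.Probability.RandomPlanarGeometry.ConformalRectangleProofs
import Literature.Probability.Percolation.QuadCrossingSquareModel
import Literature.Probability.Percolation.LatticeTraceBlocking
import Literature.Topology.PlaneTopology.PlusCrossing

/-!
# Stub C-B of line `oracle-sandwich` (crux `LoopsToCrossings`, stmt-CriticalPhenomena-4837):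
plus-position blocking

Deterministic, `X`-free lattice geometry consumed by stub C of the line: two lattice paths in
*plus position* with room `ν` in the coordinates of a plane homeomorphism `Φ` — one joining the
zone `Φ{im ≤ -yin}` to `Φ{yin ≤ im}` with all its vertices drawn in `Φ([-x, x] × [-yout, yout])`,
the other joining `Φ{re ≤ -xin}` to `Φ{xin ≤ re}` with vertices in `Φ([-xout, xout] × [-y, y])`,
`x + ν ≤ xin`, `y + ν ≤ yin` — must have crossing drawn traces, which is impossible for
(ℤ²) a primal-open path and a dual-open path of the same configuration, (𝕋) an open and a closed
site path, (𝕋/G02) a monochromatic plate path and a G02 crossing `triCrossing Q δ (arc 0) (arc 2)`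
of the other colour in a square model `Φ` of the conformal rectangle `Q`.

Proof: the drawn traces are compact connected sets; pulled back by `Φ⁻¹` (uniform continuity,
`exists_chart_room`, mesh `δ ≤ ρ(Φ, ν/2)`) the first lies in the strip `|re| ≤ x + ν/2` and meets
`{im ≤ -yin}`, `{yin ≤ im}`, the second lies in the band `|im| ≤ y + ν/2` and meets `{re ≤ -xin}`,
`{xin ≤ re}`, so they meet (`inter_nonempty_of_plus_chart`, Bollobás–Riordan 2006 Ch. 7 Claim 19);
but open primal traces miss dual-open dual traces and on `𝕋` traces of walks of different
colours are disjoint (`disjoint_meshTrace_image_dualScale_walkTrace`,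
`disjoint_triWalkTrace_of_forall_not_mem`, `LatticeTraceBlocking.lean`).  The generic plane
topology (`Literature/Topology/PlaneTopology/PlusCrossing.lean`) and the trace lemmas
(`Literature/Probability/Percolation/LatticeTraceBlocking.lean`) were landed first; this file only
instantiates them.  Source: Bollobás–Riordan, *Percolation* (2006), Ch. 7, Claim 19 p. 192;
Newman (1939), Ch. V §11.
-/

noncomputable section

namespace Summit.CriticalPhenomena.CardyFormulaZ2.Cruxes.LoopsToCrossings.OracleSandwich

open Summit.CriticalPhenomena.CardyFormulaZ2.Theses.CardyMagicRigidity
open Literature.Probability.RandomPlanarGeometry hiding cardyFunction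
open Literature.Probability.Percolation hiding cardyFunction
open Literature.Probability.LatticeModels
open Filter Topology Set MeasureTheory Metric

/-! ### Coordinates in a chart with room -/

/-- Points at distance `≤ ν` have coordinates differing by at most `ν`. [folklore] -/
private theorem re_im_near {w z : ℂ} {ν : ℝ} (h : dist w z ≤ ν) :
    z.re - ν ≤ w.re ∧ w.re ≤ z.re + ν ∧ z.im - ν ≤ w.im ∧ w.im ≤ z.im + ν := by
  rw [dist_eq_norm] at h
  have hre := (Complex.abs_re_le_norm (w - z)).trans h
  have him := (Complex.abs_im_le_norm (w - z)).trans h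
  rw [Complex.sub_re, abs_le] at hre
  rw [Complex.sub_im, abs_le] at him
  exact ⟨by linarith [hre.1], by linarith [hre.2], by linarith [him.1], by linarith [him.2]⟩

/-- Pull-back of image membership under a homeomorphism. [folklore] -/
private theorem symm_mem_of_mem_image {Φ : ℂ ≃ₜ ℂ} {S : Set ℂ} {p : ℂ} (h : p ∈ Φ '' S) :
    Φ.symm p ∈ S := by
  obtain ⟨z, hz, rfl⟩ := h
  rwa [Homeomorph.symm_apply_apply]

/-- **Room**: a point within `ρ` of a drawn point `Φ z` of the box `[-bx, bx] × [-bY, bY] ⊆ [-2, 2]²`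
pulls back into the `ν'`-neighbourhood of the box. [folklore] -/
private theorem near_box {Φ : ℂ ≃ₜ ℂ} {ρ ν' bx bY : ℝ}
    (hroom : ∀ z ∈ Icc (-2 : ℝ) 2 ×ℂ Icc (-2 : ℝ) 2, ∀ p : ℂ, dist p (Φ z) ≤ ρ →
      dist (Φ.symm p) z ≤ ν')
    (hbx : bx ≤ 2) (hbY : bY ≤ 2) {p q : ℂ} (hq : q ∈ Φ '' (Icc (-bx) bx ×ℂ Icc (-bY) bY))
    (hpq : dist p q ≤ ρ) : |(Φ.symm p).re| ≤ bx + ν' ∧ |(Φ.symm p).im| ≤ bY + ν' := by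
  obtain ⟨z, hz, rfl⟩ := hq
  rw [Complex.mem_reProdIm, mem_Icc, mem_Icc] at hz
  obtain ⟨⟨h1, h2⟩, h3, h4⟩ := hz
  have hz2 : z ∈ Icc (-2 : ℝ) 2 ×ℂ Icc (-2 : ℝ) 2 := by
    rw [Complex.mem_reProdIm, mem_Icc, mem_Icc]
    exact ⟨⟨by linarith, by linarith⟩, by linarith, by linarith⟩
  obtain ⟨e1, e2, e3, e4⟩ := re_im_near (hroom z hz2 p hpq)
  exact ⟨abs_le.2 ⟨by linarith, by linarith⟩, abs_le.2 ⟨by linarith, by linarith⟩⟩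

/-! ### The abstract blocking lemma -/

/-- **Plus-position blocking in a chart** (abstract form): a compact connected `V` pulling back
into the strip `|re| ≤ x + ν'` and meeting `Φ{im ≤ -yin}`, `Φ{yin ≤ im}`, and a compact connected
`H` pulling back into the band `|im| ≤ y + ν'` and meeting `Φ{re ≤ -xin}`, `Φ{xin ≤ re}`, with
`x + ν' ≤ xin`, `y + ν' ≤ yin`, cannot be disjoint. [cite: BollobasRiordan2006, Ch. 7 Claim 19 p. 192] -/
private theorem plus_block (Φ : ℂ ≃ₜ ℂ) {V H : Set ℂ} {x y xin yin ν' : ℝ}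
    (hx0 : 0 ≤ x + ν') (hy0 : 0 ≤ y + ν') (hx : x + ν' ≤ xin) (hy : y + ν' ≤ yin)
    (hVc : IsCompact V) (hVp : IsPreconnected V)
    (hVstrip : ∀ p ∈ V, |(Φ.symm p).re| ≤ x + ν')
    (hVbot : ∃ p ∈ V, (Φ.symm p).im ≤ -yin) (hVtop : ∃ p ∈ V, yin ≤ (Φ.symm p).im)
    (hHc : IsCompact H) (hHp : IsPreconnected H)
    (hHband : ∀ p ∈ H, |(Φ.symm p).im| ≤ y + ν')
    (hHleft : ∃ p ∈ H, (Φ.symm p).re ≤ -xin) (hHright : ∃ p ∈ H, xin ≤ (Φ.symm p).re)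
    (hdisj : Disjoint V H) : False := by
  obtain ⟨p, hpV, hpH⟩ := Literature.Topology.PlaneTopology.inter_nonempty_of_plus_chart Φ
    (a := -(x + ν')) (b := x + ν') (c := -(y + ν')) (d := y + ν') (by linarith) (by linarith)
    hVc hVp (fun p hp => abs_le.1 (hVstrip p hp))
    (by obtain ⟨p, hp, h⟩ := hVbot; exact ⟨p, hp, by linarith⟩)
    (by obtain ⟨p, hp, h⟩ := hVtop; exact ⟨p, hp, by linarith⟩)
    hHc hHp (fun p hp => abs_le.1 (hHband p hp))
    (by obtain ⟨p, hp, h⟩ := hHleft; exact ⟨p, hp, by linarith⟩)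
    (by obtain ⟨p, hp, h⟩ := hHright; exact ⟨p, hp, by linarith⟩)
  exact Set.disjoint_left.1 hdisj hpV hpH

/-- The model square `[-2, 2]²` is compact. [folklore] -/
private theorem isCompact_box_two : IsCompact (Icc (-2 : ℝ) 2 ×ℂ Icc (-2 : ℝ) 2) :=
  isCompact_Icc.reProdIm isCompact_Icc

/-! ### The three lattice instances -/

/-- **(ℤ²) primal versus dual plate paths in plus position.** [cite: BollobasRiordan2006, Ch. 7 Claim 19 p. 192] -/
private theorem zd_block {Φ : ℂ ≃ₜ ℂ} {ρ ν δ : ℝ} (hν : 0 < ν)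
    (hroom : ∀ z ∈ Icc (-2 : ℝ) 2 ×ℂ Icc (-2 : ℝ) 2, ∀ p : ℂ, dist p (Φ z) ≤ ρ →
      dist (Φ.symm p) z ≤ ν / 2)
    (hδ : 0 < δ) (hδρ : δ ≤ ρ) {x yin yout xin xout y : ℝ} (hx : 0 < x) (hxin : x + ν ≤ xin)
    (hxout : xin ≤ xout) (hxo : xout ≤ 2) (hy : 0 < y) (hyin : y + ν ≤ yin) (hyout : yin ≤ yout)
    (hyo : yout ≤ 2) {ω : BondConfig (Site 2)} (hω : ω ⊆ (zdGraph 2).edgeSet) :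
    (ω ∈ openCrossing {w : Site 2 | meshPoint δ w ∈ Φ '' (Icc (-x) x ×ℂ Icc (-yout) yout)}
        {w | meshPoint δ w ∈ Φ '' {z : ℂ | z.im ≤ -yin}} {w | meshPoint δ w ∈ Φ '' {z : ℂ | yin ≤ z.im}} →
      dualConfig ω ∈ openCrossing
        {w : Site 2 | dualScale δ (Site.toComplex w) ∈ Φ '' (Icc (-xout) xout ×ℂ Icc (-y) y)}
        {w | dualScale δ (Site.toComplex w) ∈ Φ '' {z : ℂ | z.re ≤ -xin}}
        {w | dualScale δ (Site.toComplex w) ∈ Φ '' {z : ℂ | xin ≤ z.re}} → False) ∧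
    (ω ∈ openCrossing {w : Site 2 | meshPoint δ w ∈ Φ '' (Icc (-xout) xout ×ℂ Icc (-y) y)}
        {w | meshPoint δ w ∈ Φ '' {z : ℂ | z.re ≤ -xin}} {w | meshPoint δ w ∈ Φ '' {z : ℂ | xin ≤ z.re}} →
      dualConfig ω ∈ openCrossing
        {w : Site 2 | dualScale δ (Site.toComplex w) ∈ Φ '' (Icc (-x) x ×ℂ Icc (-yout) yout)}
        {w | dualScale δ (Site.toComplex w) ∈ Φ '' {z : ℂ | z.im ≤ -yin}}
        {w | dualScale δ (Site.toComplex w) ∈ Φ '' {z : ℂ | yin ≤ z.im}} → False) := by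
  have hdc : Continuous (dualScale δ) := continuous_dualScale δ
  have hδa : |δ| = δ := abs_of_pos hδ
  constructor
  · rintro ⟨u, hu, v, hv, huv⟩ ⟨u', hu', v', hv', huv'⟩
    obtain ⟨π, hπS, hπω⟩ := exists_walk_of_mem_openConnIn hω huv
    obtain ⟨Q, hQS, hQω⟩ := exists_walk_of_mem_openConnIn (dualConfig_subset_edgeSet ω) huv'
    have hu₀ := symm_mem_of_mem_image hu
    have hv₀ := symm_mem_of_mem_image hv
    have hu₀' := symm_mem_of_mem_image hu'
    have hv₀' := symm_mem_of_mem_image hv'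
    simp only [mem_setOf_eq] at hu₀ hv₀ hu₀' hv₀'
    have hnπ : ¬ π.Nil := SimpleGraph.Walk.not_nil_of_ne (by rintro rfl; linarith)
    have hnQ : ¬ Q.Nil := SimpleGraph.Walk.not_nil_of_ne (by rintro rfl; linarith)
    refine plus_block Φ (V := meshTrace δ π) (H := dualScale δ '' walkTrace Q) (x := x) (y := y)
      (xin := xin) (yin := yin) (ν' := ν / 2) (by linarith) (by linarith) (by linarith) (by linarith)
      (isCompact_meshTrace δ π) (isPreconnected_meshTrace δ π)
      (fun p hp => by
        obtain ⟨w, hw, hd⟩ := exists_dist_meshPoint_le_of_mem_meshTrace hp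
        exact (near_box hroom (by linarith) hyo (hπS w hw) ((hδa ▸ hd).trans hδρ)).1)
      ⟨_, meshPoint_mem_meshTrace_of_mem_support hnπ π.start_mem_support, hu₀⟩
      ⟨_, meshPoint_mem_meshTrace_of_mem_support hnπ π.end_mem_support, hv₀⟩
      (isCompact_image_dualScale_walkTrace δ Q) ((isPreconnected_walkTrace Q).image _ hdc.continuousOn)
      (fun p hp => by
        obtain ⟨w, hw, hd⟩ := exists_dist_dualScale_le_of_mem_image_walkTrace hδ.le hp
        exact (near_box hroom hxo (by linarith) (hQS w hw) (hd.trans hδρ)).2)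
      ⟨_, mem_image_of_mem _ (toComplex_mem_walkTrace_of_mem_support hnQ Q.start_mem_support), hu₀'⟩
      ⟨_, mem_image_of_mem _ (toComplex_mem_walkTrace_of_mem_support hnQ Q.end_mem_support), hv₀'⟩
      (disjoint_meshTrace_image_dualScale_walkTrace hδ.ne' hπω hQω)
  · rintro ⟨u, hu, v, hv, huv⟩ ⟨u', hu', v', hv', huv'⟩
    obtain ⟨π, hπS, hπω⟩ := exists_walk_of_mem_openConnIn hω huv
    obtain ⟨Q, hQS, hQω⟩ := exists_walk_of_mem_openConnIn (dualConfig_subset_edgeSet ω) huv'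
    have hu₀ := symm_mem_of_mem_image hu
    have hv₀ := symm_mem_of_mem_image hv
    have hu₀' := symm_mem_of_mem_image hu'
    have hv₀' := symm_mem_of_mem_image hv'
    simp only [mem_setOf_eq] at hu₀ hv₀ hu₀' hv₀'
    have hnπ : ¬ π.Nil := SimpleGraph.Walk.not_nil_of_ne (by rintro rfl; linarith)
    have hnQ : ¬ Q.Nil := SimpleGraph.Walk.not_nil_of_ne (by rintro rfl; linarith)
    refine plus_block Φ (V := dualScale δ '' walkTrace Q) (H := meshTrace δ π) (x := x) (y := y)
      (xin := xin) (yin := yin) (ν' := ν / 2) (by linarith) (by linarith) (by linarith) (by linarith)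
      (isCompact_image_dualScale_walkTrace δ Q) ((isPreconnected_walkTrace Q).image _ hdc.continuousOn)
      (fun p hp => by
        obtain ⟨w, hw, hd⟩ := exists_dist_dualScale_le_of_mem_image_walkTrace hδ.le hp
        exact (near_box hroom (by linarith) hyo (hQS w hw) (hd.trans hδρ)).1)
      ⟨_, mem_image_of_mem _ (toComplex_mem_walkTrace_of_mem_support hnQ Q.start_mem_support), hu₀'⟩
      ⟨_, mem_image_of_mem _ (toComplex_mem_walkTrace_of_mem_support hnQ Q.end_mem_support), hv₀'⟩
      (isCompact_meshTrace δ π) (isPreconnected_meshTrace δ π)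
      (fun p hp => by
        obtain ⟨w, hw, hd⟩ := exists_dist_meshPoint_le_of_mem_meshTrace hp
        exact (near_box hroom hxo (by linarith) (hπS w hw) ((hδa ▸ hd).trans hδρ)).2)
      ⟨_, meshPoint_mem_meshTrace_of_mem_support hnπ π.start_mem_support, hu₀⟩
      ⟨_, meshPoint_mem_meshTrace_of_mem_support hnπ π.end_mem_support, hv₀⟩
      (disjoint_meshTrace_image_dualScale_walkTrace hδ.ne' hπω hQω).symm

/-- **(𝕋) open versus closed site plate paths in plus position.** [cite: BollobasRiordan2006, Ch. 7 Claim 19 p. 192] -/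
private theorem tri_block {Φ : ℂ ≃ₜ ℂ} {ρ ν δ : ℝ} (hν : 0 < ν)
    (hroom : ∀ z ∈ Icc (-2 : ℝ) 2 ×ℂ Icc (-2 : ℝ) 2, ∀ p : ℂ, dist p (Φ z) ≤ ρ →
      dist (Φ.symm p) z ≤ ν / 2)
    (hδ : 0 < δ) (hδρ : δ ≤ ρ) {x yin yout xin xout y : ℝ} (hx : 0 < x) (hxin : x + ν ≤ xin)
    (hxout : xin ≤ xout) (hxo : xout ≤ 2) (hy : 0 < y) (hyin : y + ν ≤ yin) (hyout : yin ≤ yout)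
    (hyo : yout ≤ 2) (ω ω' : SiteConfig (Site 2)) (hωω' : ∀ z, z ∈ ω' ↔ z ∉ ω) :
    (∃ u ∈ {w : Site 2 | triMeshPoint δ w ∈ Φ '' {z : ℂ | z.im ≤ -yin}},
        ∃ v ∈ {w : Site 2 | triMeshPoint δ w ∈ Φ '' {z : ℂ | yin ≤ z.im}},
          ω ∈ siteConnIn triGraph {w | triMeshPoint δ w ∈ Φ '' (Icc (-x) x ×ℂ Icc (-yout) yout)} u v) →
      (∃ u ∈ {w : Site 2 | triMeshPoint δ w ∈ Φ '' {z : ℂ | z.re ≤ -xin}},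
        ∃ v ∈ {w : Site 2 | triMeshPoint δ w ∈ Φ '' {z : ℂ | xin ≤ z.re}},
          ω' ∈ siteConnIn triGraph {w | triMeshPoint δ w ∈ Φ '' (Icc (-xout) xout ×ℂ Icc (-y) y)} u v) →
      False := by
  rintro ⟨u, hu, v, hv, huv⟩ ⟨u', hu', v', hv', huv'⟩
  have hδa : |δ| = δ := abs_of_pos hδ
  obtain ⟨W, hW⟩ := (mem_siteConnIn_iff_pathIn.1 huv).exists_walk
  obtain ⟨W', hW'⟩ := (mem_siteConnIn_iff_pathIn.1 huv').exists_walk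
  have hu₀ := symm_mem_of_mem_image hu
  have hv₀ := symm_mem_of_mem_image hv
  have hu₀' := symm_mem_of_mem_image hu'
  have hv₀' := symm_mem_of_mem_image hv'
  simp only [mem_setOf_eq] at hu₀ hv₀ hu₀' hv₀'
  have hnW : ¬ W.Nil := SimpleGraph.Walk.not_nil_of_ne (by rintro rfl; linarith)
  have hnW' : ¬ W'.Nil := SimpleGraph.Walk.not_nil_of_ne (by rintro rfl; linarith)
  exact plus_block Φ (V := triWalkTrace δ W) (H := triWalkTrace δ W') (x := x) (y := y)
    (xin := xin) (yin := yin) (ν' := ν / 2) (by linarith) (by linarith) (by linarith) (by linarith)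
    (isCompact_triWalkTrace δ W) (isPreconnected_triWalkTrace δ W)
    (fun p hp => by
      obtain ⟨w, hw, hd⟩ := exists_dist_triMeshPoint_le_of_mem_triWalkTrace hp
      exact (near_box hroom (by linarith) hyo (hW w hw).1 ((hδa ▸ hd).trans hδρ)).1)
    ⟨_, triMeshPoint_mem_triWalkTrace hnW W.start_mem_support, hu₀⟩
    ⟨_, triMeshPoint_mem_triWalkTrace hnW W.end_mem_support, hv₀⟩
    (isCompact_triWalkTrace δ W') (isPreconnected_triWalkTrace δ W')
    (fun p hp => by
      obtain ⟨w, hw, hd⟩ := exists_dist_triMeshPoint_le_of_mem_triWalkTrace hp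
      exact (near_box hroom hxo (by linarith) (hW' w hw).1 ((hδa ▸ hd).trans hδρ)).2)
    ⟨_, triMeshPoint_mem_triWalkTrace hnW' W'.start_mem_support, hu₀'⟩
    ⟨_, triMeshPoint_mem_triWalkTrace hnW' W'.end_mem_support, hv₀'⟩
    (disjoint_triWalkTrace_of_forall_not_mem hδ.ne' (χ := ω') (fun z hz => (hW' z hz).2)
      (fun z hz => fun h => (hωω' z).1 h (hW z hz).2))

/-- **(𝕋/G02) a monochromatic horizontal plate path versus a G02 crossing of the other colour**
in a square model `Φ` of `Q`. [cite: BollobasRiordan2006, Ch. 7 Claim 19 p. 192] -/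
private theorem g02_block {Q : ConformalRectangle} {Φ : ℂ ≃ₜ ℂ} (hΦ : IsSquareModel Q Φ)
    {ρ ν δ : ℝ} (hν : 0 < ν)
    (hroom : ∀ z ∈ Icc (-2 : ℝ) 2 ×ℂ Icc (-2 : ℝ) 2, ∀ p : ℂ, dist p (Φ z) ≤ ρ →
      dist (Φ.symm p) z ≤ ν / 2)
    (hδ : 0 < δ) (hδρ : δ ≤ ρ) {xin xout y : ℝ} (hxin : 1 + ν ≤ xin)
    (hxo : xout ≤ 2) (hy : 0 < y) (hy1 : y + ν ≤ 1) (ω ω' : SiteConfig (Site 2))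
    (hωω' : ∀ z, z ∈ ω' ↔ z ∉ ω) :
    (∃ u ∈ {w : Site 2 | triMeshPoint δ w ∈ Φ '' {z : ℂ | z.re ≤ -xin}},
        ∃ v ∈ {w : Site 2 | triMeshPoint δ w ∈ Φ '' {z : ℂ | xin ≤ z.re}},
          ω ∈ siteConnIn triGraph {w | triMeshPoint δ w ∈ Φ '' (Icc (-xout) xout ×ℂ Icc (-y) y)} u v) →
      ω' ∈ triCrossing Q.carrier δ (Q.arc 0) (Q.arc 2) → False := by
  rintro ⟨u, hu, v, hv, huv⟩ ⟨xg, hxg, yg, hyg, hconn⟩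
  have hδa : |δ| = δ := abs_of_pos hδ
  obtain ⟨W, hW⟩ := (mem_siteConnIn_iff_pathIn.1 huv).exists_walk
  obtain ⟨π, hπω, hπtr⟩ := exists_triWalk_of_pathIn_domain (mem_siteConnIn_iff_pathIn.1 hconn)
  have hu₀ := symm_mem_of_mem_image hu
  have hv₀ := symm_mem_of_mem_image hv
  simp only [mem_setOf_eq] at hu₀ hv₀
  -- the endpoints of the G02 crossing pull back near the bottom and top sides
  have hend : ∀ (k : Fin 4) (s : Site 2), s ∈ triDiscreteArc Q.carrier δ (Q.arc k) →
      ∃ z₀ ∈ unitSquareQuad.arc k, dist (Φ.symm (triMeshPoint δ s)) z₀ ≤ ν / 2 := by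
    intro k s hs
    have hinf := infDist_le_of_mem_triDiscreteArc Q.isOpen hs
    rw [hδa] at hinf
    obtain ⟨q, hq, hdq⟩ := (Q.isCompact_arc k).exists_infDist_eq_dist ⟨_, Q.pt_mem_arc_self k⟩
      (triMeshPoint δ s)
    rw [← hΦ.image_arc k] at hq
    obtain ⟨z₀, hz₀, rfl⟩ := hq
    refine ⟨z₀, hz₀, hroom z₀ ?_ _ (hdq ▸ hinf.trans hδρ)⟩
    have hfr : z₀ ∈ Icc (-1 : ℝ) 1 ×ℂ Icc (-1 : ℝ) 1 := by
      have hcl : closure unitSquareQuad.carrier = Icc (-1 : ℝ) 1 ×ℂ Icc (-1 : ℝ) 1 := by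
        rw [unitSquareQuad_carrier, Complex.closure_reProdIm, closure_Ioo (by norm_num)]
      exact hcl ▸ frontier_subset_closure (unitSquareQuad.arc_subset_frontier k hz₀)
    rw [Complex.mem_reProdIm, mem_Icc, mem_Icc] at hfr ⊢
    exact ⟨⟨by linarith [hfr.1.1], by linarith [hfr.1.2]⟩, by linarith [hfr.2.1], by linarith [hfr.2.2]⟩
  obtain ⟨z₀, hz₀, hdz₀⟩ := hend 0 xg hxg
  obtain ⟨z₂, hz₂, hdz₂⟩ := hend 2 yg hyg
  rw [SquareModel.mem_arc_zero] at hz₀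
  rw [SquareModel.mem_arc_two] at hz₂
  obtain ⟨-, -, -, e0⟩ := re_im_near hdz₀
  obtain ⟨-, -, e2, -⟩ := re_im_near hdz₂
  rw [hz₀.1] at e0
  rw [hz₂.1] at e2
  have hν1 : ν < 1 := by linarith
  have hnπ : ¬ π.Nil := SimpleGraph.Walk.not_nil_of_ne (by rintro rfl; linarith)
  have hnW : ¬ W.Nil := SimpleGraph.Walk.not_nil_of_ne (by rintro rfl; linarith)
  have hclos : closure Q.carrier = Φ '' (Icc (-1) 1 ×ℂ Icc (-1) 1) := hΦ.image_Icc.symm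
  refine plus_block Φ (V := triWalkTrace δ π) (H := triWalkTrace δ W) (x := 1) (y := y)
    (xin := xin) (yin := 1 - ν / 2) (ν' := ν / 2) (by linarith) (by linarith) (by linarith)
    (by linarith) (isCompact_triWalkTrace δ π) (isPreconnected_triWalkTrace δ π) ?_
    ⟨_, triMeshPoint_mem_triWalkTrace hnπ π.start_mem_support, by linarith⟩
    ⟨_, triMeshPoint_mem_triWalkTrace hnπ π.end_mem_support, by linarith⟩
    (isCompact_triWalkTrace δ W) (isPreconnected_triWalkTrace δ W)
    (fun p hp => by
      obtain ⟨w, hw, hd⟩ := exists_dist_triMeshPoint_le_of_mem_triWalkTrace hp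
      exact (near_box hroom hxo (by linarith) (hW w hw).1 ((hδa ▸ hd).trans hδρ)).2)
    ⟨_, triMeshPoint_mem_triWalkTrace hnW W.start_mem_support, hu₀⟩
    ⟨_, triMeshPoint_mem_triWalkTrace hnW W.end_mem_support, hv₀⟩
    (disjoint_triWalkTrace_of_forall_not_mem hδ.ne' (χ := ω) (fun z hz => (hW z hz).2)
      (fun z hz => (hωω' z).1 (hπω z hz)))
  intro p hp
  have hp' := symm_mem_of_mem_image ((hclos ▸ hπtr) hp)
  rw [Complex.mem_reProdIm, mem_Icc, mem_Icc] at hp'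
  exact abs_le.2 ⟨by linarith [hp'.1.1], by linarith [hp'.1.2]⟩

/-- **Stub C-B — plus-position blocking** (X-free, deterministic), three parts.  (ℤ²) a primal
open plate path and a dual open plate path in plus position — the horizontal one joins
`Φ{re ≤ -xin}` to `Φ{xin ≤ re}` inside `Φ([-xout,xout]×[-y,y])`, the vertical one joins
`Φ{im ≤ -yin}` to `Φ{yin ≤ im}` inside `Φ([-x,x]×[-yout,yout])`, with `x + ν ≤ xin`,
`y + ν ≤ yin` — cannot coexist; (𝕋) the same for an open site path and a closed site path
(`siteConnIn triGraph`, sites drawn by `triMeshPoint δ`); (𝕋/G02) for a square model `Φ` of a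
conformal rectangle `Q` (`IsSquareModel Q Φ`), an open (resp. closed) horizontal plate path with
zones `1 + ν ≤ xin` beyond the lateral arcs and height `y + ν ≤ 1` excludes the closed (resp. open)
G02 crossing `triCrossing Q.carrier δ (Q.arc 0) (Q.arc 2)` of the complementary configuration.
Proof: pull back by `Φ⁻¹` with room `ν/2` (`exists_chart_room`, mesh `δ ≤ ρ(Φ, ν/2)`); the drawn
traces are compact connected sets in plus position, hence meet
(`Literature.Topology.PlaneTopology.inter_nonempty_of_plus_chart`); but an open primal trace
misses a dual-open dual trace (`disjoint_walkTrace_image_walkTrace`) and on `𝕋` traces of walks of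
different colours are disjoint (`disjoint_segment_triWalkTrace`); a G02 crossing runs inside
`closure Q = Φ([-1,1]²)` from within `δ` of `Q.arc 0 = Φ{im = -1}` to within `δ` of `Q.arc 2`
(`infDist_le_of_mem_triDiscreteArc`). [cite: BollobasRiordan2006, Ch. 7 Claim 19 p. 192] -/
theorem stub_plusBlocking :
    (∀ (Φ : ℂ ≃ₜ ℂ) (ν : ℝ), 0 < ν → ∃ δ₀ : ℝ, 0 < δ₀ ∧ ∀ δ : ℝ, 0 < δ → δ ≤ δ₀ →
      ∀ (x yin yout xin xout y : ℝ), 0 < x → x + ν ≤ xin → xin ≤ xout → xout ≤ 2 →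
        0 < y → y + ν ≤ yin → yin ≤ yout → yout ≤ 2 →
        ∀ ω : BondConfig (Site 2), ω ⊆ (zdGraph 2).edgeSet →
          (ω ∈ openCrossing {w : Site 2 | meshPoint δ w ∈ Φ '' (Icc (-x) x ×ℂ Icc (-yout) yout)}
              {w | meshPoint δ w ∈ Φ '' {z : ℂ | z.im ≤ -yin}} {w | meshPoint δ w ∈ Φ '' {z : ℂ | yin ≤ z.im}} →
            dualConfig ω ∈ openCrossing
              {w : Site 2 | dualScale δ (Site.toComplex w) ∈ Φ '' (Icc (-xout) xout ×ℂ Icc (-y) y)}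
              {w | dualScale δ (Site.toComplex w) ∈ Φ '' {z : ℂ | z.re ≤ -xin}}
              {w | dualScale δ (Site.toComplex w) ∈ Φ '' {z : ℂ | xin ≤ z.re}} → False) ∧
          (ω ∈ openCrossing {w : Site 2 | meshPoint δ w ∈ Φ '' (Icc (-xout) xout ×ℂ Icc (-y) y)}
              {w | meshPoint δ w ∈ Φ '' {z : ℂ | z.re ≤ -xin}} {w | meshPoint δ w ∈ Φ '' {z : ℂ | xin ≤ z.re}} →
            dualConfig ω ∈ openCrossing
              {w : Site 2 | dualScale δ (Site.toComplex w) ∈ Φ '' (Icc (-x) x ×ℂ Icc (-yout) yout)}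
              {w | dualScale δ (Site.toComplex w) ∈ Φ '' {z : ℂ | z.im ≤ -yin}}
              {w | dualScale δ (Site.toComplex w) ∈ Φ '' {z : ℂ | yin ≤ z.im}} → False)) ∧
    (∀ (Φ : ℂ ≃ₜ ℂ) (ν : ℝ), 0 < ν → ∃ δ₀ : ℝ, 0 < δ₀ ∧ ∀ δ : ℝ, 0 < δ → δ ≤ δ₀ →
      ∀ (x yin yout xin xout y : ℝ), 0 < x → x + ν ≤ xin → xin ≤ xout → xout ≤ 2 →
        0 < y → y + ν ≤ yin → yin ≤ yout → yout ≤ 2 →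
        ∀ ω : SiteConfig (Site 2),
          ((∃ u ∈ {w : Site 2 | triMeshPoint δ w ∈ Φ '' {z : ℂ | z.im ≤ -yin}},
              ∃ v ∈ {w : Site 2 | triMeshPoint δ w ∈ Φ '' {z : ℂ | yin ≤ z.im}},
                ω ∈ siteConnIn triGraph {w | triMeshPoint δ w ∈ Φ '' (Icc (-x) x ×ℂ Icc (-yout) yout)} u v) →
            (∃ u ∈ {w : Site 2 | triMeshPoint δ w ∈ Φ '' {z : ℂ | z.re ≤ -xin}},
              ∃ v ∈ {w : Site 2 | triMeshPoint δ w ∈ Φ '' {z : ℂ | xin ≤ z.re}},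
                ωᶜ ∈ siteConnIn triGraph {w | triMeshPoint δ w ∈ Φ '' (Icc (-xout) xout ×ℂ Icc (-y) y)} u v) →
            False) ∧
          ((∃ u ∈ {w : Site 2 | triMeshPoint δ w ∈ Φ '' {z : ℂ | z.re ≤ -xin}},
              ∃ v ∈ {w : Site 2 | triMeshPoint δ w ∈ Φ '' {z : ℂ | xin ≤ z.re}},
                ω ∈ siteConnIn triGraph {w | triMeshPoint δ w ∈ Φ '' (Icc (-xout) xout ×ℂ Icc (-y) y)} u v) →
            (∃ u ∈ {w : Site 2 | triMeshPoint δ w ∈ Φ '' {z : ℂ | z.im ≤ -yin}},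
              ∃ v ∈ {w : Site 2 | triMeshPoint δ w ∈ Φ '' {z : ℂ | yin ≤ z.im}},
                ωᶜ ∈ siteConnIn triGraph {w | triMeshPoint δ w ∈ Φ '' (Icc (-x) x ×ℂ Icc (-yout) yout)} u v) →
            False)) ∧
    (∀ (Q : ConformalRectangle) (Φ : ℂ ≃ₜ ℂ), IsSquareModel Q Φ → ∀ ν : ℝ, 0 < ν →
      ∃ δ₀ : ℝ, 0 < δ₀ ∧ ∀ δ : ℝ, 0 < δ → δ ≤ δ₀ →
        ∀ (xin xout y : ℝ), 1 + ν ≤ xin → xin ≤ xout → xout ≤ 2 → 0 < y → y + ν ≤ 1 →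
          ∀ ω : SiteConfig (Site 2),
            ((∃ u ∈ {w : Site 2 | triMeshPoint δ w ∈ Φ '' {z : ℂ | z.re ≤ -xin}},
                ∃ v ∈ {w : Site 2 | triMeshPoint δ w ∈ Φ '' {z : ℂ | xin ≤ z.re}},
                  ω ∈ siteConnIn triGraph {w | triMeshPoint δ w ∈ Φ '' (Icc (-xout) xout ×ℂ Icc (-y) y)} u v) →
              ωᶜ ∈ triCrossing Q.carrier δ (Q.arc 0) (Q.arc 2) → False) ∧
            ((∃ u ∈ {w : Site 2 | triMeshPoint δ w ∈ Φ '' {z : ℂ | z.re ≤ -xin}},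
                ∃ v ∈ {w : Site 2 | triMeshPoint δ w ∈ Φ '' {z : ℂ | xin ≤ z.re}},
                  ωᶜ ∈ siteConnIn triGraph {w | triMeshPoint δ w ∈ Φ '' (Icc (-xout) xout ×ℂ Icc (-y) y)} u v) →
              ω ∈ triCrossing Q.carrier δ (Q.arc 0) (Q.arc 2) → False)) := by
  refine ⟨fun Φ ν hν => ?_, fun Φ ν hν => ?_, fun Q Φ hΦ ν hν => ?_⟩
  · obtain ⟨ρ, hρ, hroom⟩ := Literature.Topology.PlaneTopology.exists_chart_room Φ
      isCompact_box_two (half_pos hν)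
    refine ⟨ρ, hρ, fun δ hδ hδρ x yin yout xin xout y hx hxin hxout hxo hy hyin hyout hyo ω hω => ?_⟩
    exact zd_block hν hroom hδ hδρ hx hxin hxout hxo hy hyin hyout hyo hω
  · obtain ⟨ρ, hρ, hroom⟩ := Literature.Topology.PlaneTopology.exists_chart_room Φ
      isCompact_box_two (half_pos hν)
    refine ⟨ρ, hρ, fun δ hδ hδρ x yin yout xin xout y hx hxin hxout hxo hy hyin hyout hyo ω =>
      ⟨?_, fun hH hV => ?_⟩⟩
    · exact tri_block hν hroom hδ hδρ hx hxin hxout hxo hy hyin hyout hyo ω ωᶜ (fun z => Iff.rfl)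
    · exact tri_block hν hroom hδ hδρ hx hxin hxout hxo hy hyin hyout hyo ωᶜ ω
        (fun z => Set.notMem_compl_iff.symm) hV hH
  · obtain ⟨ρ, hρ, hroom⟩ := Literature.Topology.PlaneTopology.exists_chart_room Φ
      isCompact_box_two (half_pos hν)
    refine ⟨ρ, hρ, fun δ hδ hδρ xin xout y hxin _ hxo hy hy1 ω => ⟨?_, ?_⟩⟩
    · exact g02_block hΦ hν hroom hδ hδρ hxin hxo hy hy1 ω ωᶜ (fun z => Iff.rfl)
    · exact g02_block hΦ hν hroom hδ hδρ hxin hxo hy hy1 ωᶜ ω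
        (fun z => Set.notMem_compl_iff.symm)

end Summit.CriticalPhenomena.CardyFormulaZ2.Cruxes.LoopsToCrossings.OracleSandwich
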